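import Mathlib
import Summits.NavierStokesRegularity.NavierStokesRegularity.Theorems.EulerZoomLiouvillePowerGaugeEulerLiouvilleClassIsometry
import Summits.NavierStokesRegularity.NavierStokesRegularity.Theorems.EulerZoomLiouvillePowerGaugeEulerLiouvilleSelfSimilarSwirlFatTail
import HarnessLib

/-!
# Crux E `PowerGaugeEulerLiouville` (stmt-NavierStokesRegularity-19832), THE ONE STATEMENT: profile strata ABOUT ANY AXIS — a generic conjugation lemma for
# exactly self-similar members, and the four SWIRL-RATCHET strata about every axis through the blow-up point (width seat ns-ezl-w3 g3)

Route №10 `EulerZoomLiouville` (NavierStokesRegularity), crux E; LEAD ns-typeII-p2 g12.  Seregin's class is `O(3)`-invariant (ns-ezl-w2 g3 `…ClassIsometry`, p642230: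
`isSuitableWeakSolutionOn_conj_isometry`, `hasWeakSpatialGradientOn_conj_isometry`, `gauge_conj_isometry`; distributional half ns-ezl-w3 g3 p639628), and the
self-similar ansatz commutes with linear isometries.  Hence:

* `ClassIsometry.selfSimilar_ae_eq_zero_of_conj` — **GENERIC TRANSPORT**: an exactly self-similar member (any rate `γ`, profile `(V, P)`) is trivial as soon as EVERY class member
  with the CONJUGATED profile `(y ↦ R V(R⁻¹y), P ∘ R⁻¹)` and the same class constant is trivial (`R` any linear isometry of `ℝ³`).  With it the LEAD can put one `∃ R` around any
  profile-level stratum of THE ONE STATEMENT: `(∃ R, Stratum (R-conj V)) ⇒ u = 0 a.e.` by `obtain ⟨R, h⟩; exact selfSimilar_ae_eq_zero_of_conj … R (fun … => filler … h)`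
  (ns-ezl-w2 g3's `NeedleRace.selfSimilar_ae_eq_zero_of_axisymNoSwirlC2_conj`, p642311, is the (S37) instance).
* THE SWIRL RATCHET ABOUT ANY AXIS: `SwirlRatchet.selfSimilar_ae_eq_zero_of_axisym_boundedSwirl_C2_conj`, `…_finiteSwirlSupport_C2_conj`, `…_swirlCasimir_C2_conj`,
  `…_slowInflow_C2_conj` — the members of `…SwirlRatchet` / `…SwirlVolumeLaw` / `…SwirlFatTail` / `…SwirlRatchetSlow` with `IsAxisymmetric`, the swirl bound / support / Casimir
  read on the conjugated profile `y ↦ R V(R⁻¹ y)`; linear growth and the inflow bound `⟪z, γz + V z⟫ ≥ −(c₁‖z‖² + D)` are conjugation-invariant and stay on `V`.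

WHAT THIS IS NOT: not NS regularity, not the crux E — by-name transport of strata of the crux CLASS 19832 (MODEL lattice; E/NS strata) `--supports` stmt-19832; 19832 OPEN.
[folklore; MajdaBertozziCUP2002 §1.2 Prop. 1.1 (iii); Chae2007CMPEuler Thm 2.2]
-/

noncomputable section

-- flat `Theorems/<Route><Decl>…` files of one crux share the namespace of the crux (tree convention: `Summit.<S>.<S>.…`)
set_option linter.dupNamespace false

open MeasureTheory Set Filter Topology Metric Function InnerProductSpace
open scoped RealInnerProductSpace NNReal ContDiff

namespace Summit.NavierStokesRegularity.NavierStokesRegularity.Theorems.PowerGaugeEulerLiouville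

open Literature.Analysis Literature.Analysis.FluidPDE Literature.Analysis.FunctionSpaces

variable {u : ℝ → EuclideanSpace ℝ (Fin 3) → EuclideanSpace ℝ (Fin 3)} {p : ℝ → EuclideanSpace ℝ (Fin 3) → ℝ}
  {H : ℝ → EuclideanSpace ℝ (Fin 3) → EuclideanSpace ℝ (Fin 3) →L[ℝ] EuclideanSpace ℝ (Fin 3)} {c : ℝ≥0}
  {V : EuclideanSpace ℝ (Fin 3) → EuclideanSpace ℝ (Fin 3)} {P : EuclideanSpace ℝ (Fin 3) → ℝ}

namespace ClassIsometry

/-- **GENERIC CONJUGATION LEMMA FOR EXACTLY SELF-SIMILAR MEMBERS.**  Crux binders verbatim (suitable weak Euler on `(−∞,0) × ℝ³`, weak gradient `H`, gauges with exponent `ρ`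
bounded by `c` at every scale) + the exactly self-similar ansatz about the origin at rate `γ` with profile `(V, P)`; `R` a linear isometry of `ℝ³`.  If EVERY triple `(u′, p′, H′)`
satisfying the same three crux binders whose velocity/pressure are the ansatz of the CONJUGATED profile `(y ↦ R V(R⁻¹y), y ↦ P(R⁻¹y))` is a.e. zero on the slab, then so is
`u` (apply the hypothesis to the conjugated member — ns-ezl-w2 g3's `isSuitableWeakSolutionOn_conj_isometry` / `hasWeakSpatialGradientOn_conj_isometry` / `gauge_conj_isometry` —
and pull the vanishing back along the measure-preserving `(s, x) ↦ (s, R x)`). [folklore; MajdaBertozziCUP2002 §1.2 Prop. 1.1 (iii)] -/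
theorem selfSimilar_ae_eq_zero_of_conj {ρ γ : ℝ}
    (hsw : IsSuitableWeakSolutionOn (slab (EuclideanSpace ℝ (Fin 3)) (Iio 0) isOpen_Iio) 0 0 u p)
    (hH : HasWeakSpatialGradientOn (slab (EuclideanSpace ℝ (Fin 3)) (Iio 0) isOpen_Iio) u H)
    (hgauge : ∀ a : ℝ, 0 < a →
      ENNReal.ofReal (a ^ (2 * ρ)) * cknA a (0 : ℝ × EuclideanSpace ℝ (Fin 3)) u +
          ENNReal.ofReal (a ^ ρ) * cknE a (0 : ℝ × EuclideanSpace ℝ (Fin 3)) H +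
        ENNReal.ofReal (a ^ (2 * ρ)) * cknD a (0 : ℝ × EuclideanSpace ℝ (Fin 3)) p ≤ (c : ENNReal))
    (hu : ∀ τ : ℝ, τ < 0 → u τ = selfSimilarCollapse γ 0 V τ)
    (hp : ∀ τ : ℝ, τ < 0 → p τ = selfSimilarCollapsePressure γ 0 P τ)
    (R : EuclideanSpace ℝ (Fin 3) ≃ₗᵢ[ℝ] EuclideanSpace ℝ (Fin 3))
    (hkill : ∀ (u' : ℝ → EuclideanSpace ℝ (Fin 3) → EuclideanSpace ℝ (Fin 3)) (p' : ℝ → EuclideanSpace ℝ (Fin 3) → ℝ)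
        (H' : ℝ → EuclideanSpace ℝ (Fin 3) → EuclideanSpace ℝ (Fin 3) →L[ℝ] EuclideanSpace ℝ (Fin 3)),
      IsSuitableWeakSolutionOn (slab (EuclideanSpace ℝ (Fin 3)) (Iio 0) isOpen_Iio) 0 0 u' p' →
      HasWeakSpatialGradientOn (slab (EuclideanSpace ℝ (Fin 3)) (Iio 0) isOpen_Iio) u' H' →
      (∀ a : ℝ, 0 < a →
        ENNReal.ofReal (a ^ (2 * ρ)) * cknA a (0 : ℝ × EuclideanSpace ℝ (Fin 3)) u' +
            ENNReal.ofReal (a ^ ρ) * cknE a (0 : ℝ × EuclideanSpace ℝ (Fin 3)) H' +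
          ENNReal.ofReal (a ^ (2 * ρ)) * cknD a (0 : ℝ × EuclideanSpace ℝ (Fin 3)) p' ≤ (c : ENNReal)) →
      (∀ τ : ℝ, τ < 0 → u' τ = selfSimilarCollapse γ 0 (fun y => R (V (R.symm y))) τ) →
      (∀ τ : ℝ, τ < 0 → p' τ = selfSimilarCollapsePressure γ 0 (fun y => P (R.symm y)) τ) →
      uncurry u' =ᵐ[volume.restrict (Iio (0 : ℝ) ×ˢ (univ : Set (EuclideanSpace ℝ (Fin 3))))] 0) :
    uncurry u =ᵐ[volume.restrict (Iio (0 : ℝ) ×ˢ (univ : Set (EuclideanSpace ℝ (Fin 3))))] 0 := by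
  -- adapted from ns-ezl-w2 g3's `NeedleRace.selfSimilar_ae_eq_zero_of_axisymNoSwirlC2_conj` (p642311)
  -- the conjugated member
  have hsw' := isSuitableWeakSolutionOn_conj_isometry isOpen_Iio hsw R
  have hf0 : (fun (s : ℝ) (x : EuclideanSpace ℝ (Fin 3)) =>
      R ((0 : ℝ → EuclideanSpace ℝ (Fin 3) → EuclideanSpace ℝ (Fin 3)) s (R.symm x))) = 0 := by
    funext s x
    simp
  rw [hf0] at hsw'
  have hH' := hasWeakSpatialGradientOn_conj_isometry isOpen_Iio hH R
  have hgauge' := gauge_conj_isometry R hgauge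
  have hu' : ∀ τ : ℝ, τ < 0 → (fun s x => R (u s (R.symm x))) τ =
      selfSimilarCollapse γ 0 (fun y => R (V (R.symm y))) τ := by
    intro τ hτ
    funext x
    simp only [hu τ hτ, selfSimilarCollapse_apply, map_smul]
  have hp' : ∀ τ : ℝ, τ < 0 → (fun s x => p s (R.symm x)) τ =
      selfSimilarCollapsePressure γ 0 (fun y => P (R.symm y)) τ := by
    intro τ hτ
    funext x
    simp only [hp τ hτ, selfSimilarCollapsePressure_apply, LinearIsometryEquiv.map_smul]
  -- kill the conjugated member
  have h' := hkill _ _ _ hsw' hH' hgauge' hu' hp'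
  -- pull the vanishing back along `(s, x) ↦ (s, R x)`
  set Ψ : ℝ × EuclideanSpace ℝ (Fin 3) → ℝ × EuclideanSpace ℝ (Fin 3) := fun z => (z.1, R z.2) with hΨ
  have hΨmp : MeasurePreserving Ψ
      (volume.restrict (Iio (0 : ℝ) ×ˢ (univ : Set (EuclideanSpace ℝ (Fin 3)))))
      (volume.restrict (Iio (0 : ℝ) ×ˢ (univ : Set (EuclideanSpace ℝ (Fin 3))))) := by
    have h1 := (PressureSlaving.measurePreserving_prod_isometry R).restrict_preimage_emb
      (PressureSlaving.measurableEmbedding_prod_isometry R) (Iio (0 : ℝ) ×ˢ (univ : Set (EuclideanSpace ℝ (Fin 3))))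
    rwa [PressureSlaving.preimage_prod_isometry_slab] at h1
  have h2 : ∀ᵐ z ∂(volume.restrict (Iio (0 : ℝ) ×ˢ (univ : Set (EuclideanSpace ℝ (Fin 3))))),
      uncurry (fun s x => R (u s (R.symm x))) (Ψ z) = (0 : ℝ × EuclideanSpace ℝ (Fin 3) → EuclideanSpace ℝ (Fin 3)) (Ψ z) :=
    hΨmp.quasiMeasurePreserving.tendsto_ae.eventually h'
  filter_upwards [h2] with z hz
  have hz' : R (u z.1 z.2) = 0 := by simpa [hΨ, uncurry] using hz
  show u z.1 z.2 = 0
  simpa using hz'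

/-- Linear growth is conjugation-invariant. [folklore] -/
theorem linearGrowth_conj (R : EuclideanSpace ℝ (Fin 3) ≃ₗᵢ[ℝ] EuclideanSpace ℝ (Fin 3)) {K₁ : ℝ}
    (hlin : ∀ y, ‖V y‖ ≤ K₁ * (1 + ‖y‖)) (y : EuclideanSpace ℝ (Fin 3)) :
    ‖R (V (R.symm y))‖ ≤ K₁ * (1 + ‖y‖) := by
  rw [LinearIsometryEquiv.norm_map]
  have h := hlin (R.symm y)
  rwa [LinearIsometryEquiv.norm_map] at h

/-- The inflow bound `⟪z, γz + V z⟫ ≥ −(c₁‖z‖² + D)` is conjugation-invariant. [folklore] -/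
theorem inflowBound_conj (R : EuclideanSpace ℝ (Fin 3) ≃ₗᵢ[ℝ] EuclideanSpace ℝ (Fin 3)) {γ c₁ D : ℝ}
    (hslow : ∀ z : EuclideanSpace ℝ (Fin 3), -(c₁ * ‖z‖ ^ 2 + D) ≤ ⟪z, selfSimilarTransport γ 0 V z⟫)
    (z : EuclideanSpace ℝ (Fin 3)) :
    -(c₁ * ‖z‖ ^ 2 + D) ≤ ⟪z, selfSimilarTransport γ 0 (fun y => R (V (R.symm y))) z⟫ := by
  have h := hslow (R.symm z)
  rw [LinearIsometryEquiv.norm_map] at h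
  simp only [selfSimilarTransport_apply, sub_zero] at h ⊢
  have e : ⟪z, γ • z + R (V (R.symm z))⟫ = ⟪R.symm z, γ • R.symm z + V (R.symm z)⟫ := by
    rw [← R.symm.inner_map_map z (γ • z + R (V (R.symm z))), map_add, LinearIsometryEquiv.map_smul,
      LinearIsometryEquiv.symm_apply_apply]
  rw [e]
  exact h

end ClassIsometry

/-! ### The swirl-ratchet strata about any axis through the blow-up point -/

namespace SwirlRatchet

/-- **BOUNDED SWIRL ABOUT ANY AXIS ⇒ TRIVIAL**: `…_of_axisym_boundedSwirl_C2` with `IsAxisymmetric` and the swirl bound read on the conjugated profile `y ↦ R V(R⁻¹ y)`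
(linear growth stays on `V`). [cite: Chae2007CMPEuler, Thm 2.2 + Note added p. 6] -/
theorem selfSimilar_ae_eq_zero_of_axisym_boundedSwirl_C2_conj {ρ : ℝ} (hρ : 0 < ρ) (hρ1 : ρ ≤ 1 / 2)
    (hsw : IsSuitableWeakSolutionOn (slab (EuclideanSpace ℝ (Fin 3)) (Iio 0) isOpen_Iio) 0 0 u p)
    (hH : HasWeakSpatialGradientOn (slab (EuclideanSpace ℝ (Fin 3)) (Iio 0) isOpen_Iio) u H)
    (hgauge : ∀ a : ℝ, 0 < a →
      ENNReal.ofReal (a ^ (2 * ρ)) * cknA a (0 : ℝ × EuclideanSpace ℝ (Fin 3)) u +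
          ENNReal.ofReal (a ^ ρ) * cknE a (0 : ℝ × EuclideanSpace ℝ (Fin 3)) H +
        ENNReal.ofReal (a ^ (2 * ρ)) * cknD a (0 : ℝ × EuclideanSpace ℝ (Fin 3)) p ≤ (c : ENNReal))
    (hu : ∀ τ : ℝ, τ < 0 → u τ = selfSimilarCollapse (1 / (2 + ρ)) 0 V τ)
    (hp : ∀ τ : ℝ, τ < 0 → p τ = selfSimilarCollapsePressure (1 / (2 + ρ)) 0 P τ)
    (hV : ContDiff ℝ 2 V) (hlin : ∃ K₁ : ℝ, ∀ y, ‖V y‖ ≤ K₁ * (1 + ‖y‖))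
    (R : EuclideanSpace ℝ (Fin 3) ≃ₗᵢ[ℝ] EuclideanSpace ℝ (Fin 3))
    (hax : IsAxisymmetric (fun y => R (V (R.symm y))))
    (hbdd : ∃ B : ℝ, ∀ y, |swirl (fun y => R (V (R.symm y))) y| ≤ B) :
    uncurry u =ᵐ[volume.restrict (Iio (0 : ℝ) ×ˢ (univ : Set (EuclideanSpace ℝ (Fin 3))))] 0 := by
  obtain ⟨K₁, hK₁⟩ := hlin
  have hV' : ContDiff ℝ 2 (fun y => R (V (R.symm y))) :=
    R.toContinuousLinearEquiv.contDiff.comp (hV.comp R.symm.toContinuousLinearEquiv.contDiff)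
  exact ClassIsometry.selfSimilar_ae_eq_zero_of_conj hsw hH hgauge hu hp R fun u' p' H' hsw' hH' hg' hu' hp' =>
    selfSimilar_ae_eq_zero_of_axisym_boundedSwirl_C2 hρ hρ1 hsw' hH' hg' hu' hp' hV' hax
      ⟨K₁, ClassIsometry.linearGrowth_conj R hK₁⟩ hbdd

/-- **FINITE-VOLUME SWIRL SUPPORT ABOUT ANY AXIS ⇒ TRIVIAL** (`…_of_axisym_finiteSwirlSupport_C2` conjugated). [cite: Chae2007CMPEuler, Thm 2.2 + Note added p. 6] -/
theorem selfSimilar_ae_eq_zero_of_axisym_finiteSwirlSupport_C2_conj {ρ : ℝ} (hρ : 0 < ρ) (hρ1 : ρ ≤ 1 / 2)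
    (hsw : IsSuitableWeakSolutionOn (slab (EuclideanSpace ℝ (Fin 3)) (Iio 0) isOpen_Iio) 0 0 u p)
    (hH : HasWeakSpatialGradientOn (slab (EuclideanSpace ℝ (Fin 3)) (Iio 0) isOpen_Iio) u H)
    (hgauge : ∀ a : ℝ, 0 < a →
      ENNReal.ofReal (a ^ (2 * ρ)) * cknA a (0 : ℝ × EuclideanSpace ℝ (Fin 3)) u +
          ENNReal.ofReal (a ^ ρ) * cknE a (0 : ℝ × EuclideanSpace ℝ (Fin 3)) H +
        ENNReal.ofReal (a ^ (2 * ρ)) * cknD a (0 : ℝ × EuclideanSpace ℝ (Fin 3)) p ≤ (c : ENNReal))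
    (hu : ∀ τ : ℝ, τ < 0 → u τ = selfSimilarCollapse (1 / (2 + ρ)) 0 V τ)
    (hp : ∀ τ : ℝ, τ < 0 → p τ = selfSimilarCollapsePressure (1 / (2 + ρ)) 0 P τ)
    (hV : ContDiff ℝ 2 V) (hlin : ∃ K₁ : ℝ, ∀ y, ‖V y‖ ≤ K₁ * (1 + ‖y‖))
    (R : EuclideanSpace ℝ (Fin 3) ≃ₗᵢ[ℝ] EuclideanSpace ℝ (Fin 3))
    (hax : IsAxisymmetric (fun y => R (V (R.symm y))))
    (hfin : volume {y : EuclideanSpace ℝ (Fin 3) | swirl (fun y => R (V (R.symm y))) y ≠ 0} < ⊤) :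
    uncurry u =ᵐ[volume.restrict (Iio (0 : ℝ) ×ˢ (univ : Set (EuclideanSpace ℝ (Fin 3))))] 0 := by
  obtain ⟨K₁, hK₁⟩ := hlin
  have hV' : ContDiff ℝ 2 (fun y => R (V (R.symm y))) :=
    R.toContinuousLinearEquiv.contDiff.comp (hV.comp R.symm.toContinuousLinearEquiv.contDiff)
  exact ClassIsometry.selfSimilar_ae_eq_zero_of_conj hsw hH hgauge hu hp R fun u' p' H' hsw' hH' hg' hu' hp' =>
    selfSimilar_ae_eq_zero_of_axisym_finiteSwirlSupport_C2 hρ hρ1 hsw' hH' hg' hu' hp' hV' hax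
      ⟨K₁, ClassIsometry.linearGrowth_conj R hK₁⟩ hfin

/-- **ONE FINITE SWIRL CASIMIR (`q ≠ 3/ρ`) ABOUT ANY AXIS ⇒ TRIVIAL** (`…_of_axisym_swirlCasimir_C2` conjugated). [cite: Chae2007CMPEuler, Thm 2.1–2.2 + Note added p. 6] -/
theorem selfSimilar_ae_eq_zero_of_axisym_swirlCasimir_C2_conj {ρ : ℝ} (hρ : 0 < ρ) (hρ1 : ρ ≤ 1 / 2)
    (hsw : IsSuitableWeakSolutionOn (slab (EuclideanSpace ℝ (Fin 3)) (Iio 0) isOpen_Iio) 0 0 u p)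
    (hH : HasWeakSpatialGradientOn (slab (EuclideanSpace ℝ (Fin 3)) (Iio 0) isOpen_Iio) u H)
    (hgauge : ∀ a : ℝ, 0 < a →
      ENNReal.ofReal (a ^ (2 * ρ)) * cknA a (0 : ℝ × EuclideanSpace ℝ (Fin 3)) u +
          ENNReal.ofReal (a ^ ρ) * cknE a (0 : ℝ × EuclideanSpace ℝ (Fin 3)) H +
        ENNReal.ofReal (a ^ (2 * ρ)) * cknD a (0 : ℝ × EuclideanSpace ℝ (Fin 3)) p ≤ (c : ENNReal))
    (hu : ∀ τ : ℝ, τ < 0 → u τ = selfSimilarCollapse (1 / (2 + ρ)) 0 V τ)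
    (hp : ∀ τ : ℝ, τ < 0 → p τ = selfSimilarCollapsePressure (1 / (2 + ρ)) 0 P τ)
    (hV : ContDiff ℝ 2 V) (hlin : ∃ K₁ : ℝ, ∀ y, ‖V y‖ ≤ K₁ * (1 + ‖y‖))
    (R : EuclideanSpace ℝ (Fin 3) ≃ₗᵢ[ℝ] EuclideanSpace ℝ (Fin 3))
    (hax : IsAxisymmetric (fun y => R (V (R.symm y))))
    (hLp : ∃ q : ℝ, 0 < q ∧ q ≠ 3 / ρ ∧ ∫⁻ y, ENNReal.ofReal (|swirl (fun y => R (V (R.symm y))) y| ^ q) < ⊤) :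
    uncurry u =ᵐ[volume.restrict (Iio (0 : ℝ) ×ˢ (univ : Set (EuclideanSpace ℝ (Fin 3))))] 0 := by
  obtain ⟨K₁, hK₁⟩ := hlin
  have hV' : ContDiff ℝ 2 (fun y => R (V (R.symm y))) :=
    R.toContinuousLinearEquiv.contDiff.comp (hV.comp R.symm.toContinuousLinearEquiv.contDiff)
  exact ClassIsometry.selfSimilar_ae_eq_zero_of_conj hsw hH hgauge hu hp R fun u' p' H' hsw' hH' hg' hu' hp' =>
    selfSimilar_ae_eq_zero_of_axisym_swirlCasimir_C2 hρ hρ1 hsw' hH' hg' hu' hp' hV' hax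
      ⟨K₁, ClassIsometry.linearGrowth_conj R hK₁⟩ hLp

/-- **SLOW INFLOW ABOUT ANY AXIS ⇒ TRIVIAL** (`…_of_axisym_slowInflow_C2` conjugated; the inflow bound is conjugation-invariant and stays on `V`).
[cite: Chae2007CMPEuler, Thm 2.2 + Note added p. 6] -/
theorem selfSimilar_ae_eq_zero_of_axisym_slowInflow_C2_conj {ρ : ℝ} (hρ : 0 < ρ) (hρ1 : ρ ≤ 1 / 2)
    (hsw : IsSuitableWeakSolutionOn (slab (EuclideanSpace ℝ (Fin 3)) (Iio 0) isOpen_Iio) 0 0 u p)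
    (hH : HasWeakSpatialGradientOn (slab (EuclideanSpace ℝ (Fin 3)) (Iio 0) isOpen_Iio) u H)
    (hgauge : ∀ a : ℝ, 0 < a →
      ENNReal.ofReal (a ^ (2 * ρ)) * cknA a (0 : ℝ × EuclideanSpace ℝ (Fin 3)) u +
          ENNReal.ofReal (a ^ ρ) * cknE a (0 : ℝ × EuclideanSpace ℝ (Fin 3)) H +
        ENNReal.ofReal (a ^ (2 * ρ)) * cknD a (0 : ℝ × EuclideanSpace ℝ (Fin 3)) p ≤ (c : ENNReal))
    (hu : ∀ τ : ℝ, τ < 0 → u τ = selfSimilarCollapse (1 / (2 + ρ)) 0 V τ)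
    (hp : ∀ τ : ℝ, τ < 0 → p τ = selfSimilarCollapsePressure (1 / (2 + ρ)) 0 P τ)
    (hV : ContDiff ℝ 2 V) (hlin : ∃ K₁ : ℝ, ∀ y, ‖V y‖ ≤ K₁ * (1 + ‖y‖))
    (hslow : ∃ c₁ D : ℝ, 0 < c₁ ∧ 2 * c₁ < ρ / (2 + ρ) ∧
      ∀ z : EuclideanSpace ℝ (Fin 3), -(c₁ * ‖z‖ ^ 2 + D) ≤ ⟪z, selfSimilarTransport (1 / (2 + ρ)) 0 V z⟫)
    (R : EuclideanSpace ℝ (Fin 3) ≃ₗᵢ[ℝ] EuclideanSpace ℝ (Fin 3))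
    (hax : IsAxisymmetric (fun y => R (V (R.symm y)))) :
    uncurry u =ᵐ[volume.restrict (Iio (0 : ℝ) ×ˢ (univ : Set (EuclideanSpace ℝ (Fin 3))))] 0 := by
  obtain ⟨K₁, hK₁⟩ := hlin
  obtain ⟨c₁, D, hc₁, hgap, hsl⟩ := hslow
  have hV' : ContDiff ℝ 2 (fun y => R (V (R.symm y))) :=
    R.toContinuousLinearEquiv.contDiff.comp (hV.comp R.symm.toContinuousLinearEquiv.contDiff)
  exact ClassIsometry.selfSimilar_ae_eq_zero_of_conj hsw hH hgauge hu hp R fun u' p' H' hsw' hH' hg' hu' hp' =>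
    selfSimilar_ae_eq_zero_of_axisym_slowInflow_C2 hρ hρ1 hsw' hH' hg' hu' hp' hV' hax
      ⟨K₁, ClassIsometry.linearGrowth_conj R hK₁⟩ ⟨c₁, D, hc₁, hgap, ClassIsometry.inflowBound_conj R hsl⟩

end SwirlRatchet

end Summit.NavierStokesRegularity.NavierStokesRegularity.Theorems.PowerGaugeEulerLiouville

end
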